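import Summits.Ventures.PercRepro2.CaseOneThickeningRel

/-!
# Every instance is a thickening of a residual instance
(blind cell PercRepro2, p1 g22; the reduction half of the line of record for the uniform proof,
S5 §2.3: «the four forms everywhere ⟸ the four forms on the residual class»)

`Reducible o a₁ a₂ b v E ends` says that one thickening step applies to `(E, ends)` — a leaf
`a₃ ∉ {o, a₁, a₂, v, b}` to delete, a parallel pair to merge, a series vertex `w ∉ {o, a₁, a₂, v, b}` to
suppress, or a loop to delete; `Residual` is its negation: no unmarked leaf, no parallel pair, no unmarked
series vertex, no loop (away from the five marked vertices). Every thickening step removes one edge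
(`ThickStep.card_lt`), so by strong induction on the number of edges **every finite graph is a thickening
of a residual graph** (`exists_residual_thickening`), and with `closedAt_of_thickening`:
**`closedAt_of_residual`** — if the statement vertex `v` has the four forms for every weight vector on
every RESIDUAL graph, it has them on EVERY finite graph. The uniform statement of the rung is therefore
equivalent to its restriction to the residual class, in the kernel. Own code; standard axioms. -/

namespace Summit.Ventures.PercRepro2

namespace CaseOne

universe u

section Residual
variable {V : Type*} (o a₁ a₂ b v : V)

/-- One thickening step applies to `(E, ends)`. -/
def Reducible (E : Type u) [Fintype E] [DecidableEq E] (ends : E → Sym2 V) : Prop :=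
  ∃ (E' : Type u) (_ : Fintype E') (_ : DecidableEq E') (ends' : E' → Sym2 V),
    ThickStep o a₁ a₂ b v E' ends' E ends

/-- **Residual**: no thickening step applies — no leaf `∉ {o, a₁, a₂, v, b}`, no parallel pair, no
series vertex `∉ {o, a₁, a₂, v, b}`, no loop. -/
def Residual (E : Type u) [Fintype E] [DecidableEq E] (ends : E → Sym2 V) : Prop :=
  ¬ Reducible o a₁ a₂ b v E ends

variable {o a₁ a₂ b v}

/-- A thickening step adds one edge. -/
theorem ThickStep.card_lt {E' : Type u} [Fintype E'] [DecidableEq E'] {ends' : E' → Sym2 V}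
    {E : Type u} [Fintype E] [DecidableEq E] {ends : E → Sym2 V}
    (h : ThickStep o a₁ a₂ b v E' ends' E ends) : Fintype.card E' < Fintype.card E := by
  cases h with
  | leaf E ends u a₃ e₀ hl ho h1 h2 hv hb => exact Fintype.card_subtype_lt (x := e₀) (by simp)
  | par E ends e₀ e₁ hpar hne => exact Fintype.card_subtype_lt (x := e₁) (by simp)
  | series E ends x w z e₀ e₁ hs ho h1 h2 hv hb => exact Fintype.card_subtype_lt (x := e₁) (by simp)
  | loop E ends x e₀ hl => exact Fintype.card_subtype_lt (x := e₀) (by simp)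

/-- **Every finite graph is a thickening of a residual graph**: strong induction on the number of
edges, one thickening step at a time. -/
theorem exists_residual_thickening :
    ∀ (n : ℕ) (E : Type u) [Fintype E] [DecidableEq E] (ends : E → Sym2 V), Fintype.card E = n →
      ∃ (E' : Type u) (_ : Fintype E') (_ : DecidableEq E') (ends' : E' → Sym2 V),
        Residual o a₁ a₂ b v E' ends' ∧ Thickening o a₁ a₂ b v E' ends' E ends := by
  intro n
  induction n using Nat.strong_induction_on with
  | _ n ih =>
    intro E _ _ ends hn
    by_cases hred : Reducible o a₁ a₂ b v E ends
    · obtain ⟨E₁, _, _, ends₁, hstep⟩ := hred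
      have hlt : Fintype.card E₁ < n := hn ▸ hstep.card_lt
      obtain ⟨E', _, _, ends', hres, hth⟩ := ih _ hlt E₁ ends₁ rfl
      exact ⟨E', _, _, ends', hres, Thickening.tail hth hstep⟩
    · exact ⟨E, _, _, ends, hred, Thickening.refl E ends⟩

variable {R : Type*} [CommRing R] [LinearOrder R] [IsStrictOrderedRing R]

/-- **The reduction to the residual class**: if `v` has the four forms for every weight vector on every
residual graph, it has them on every finite graph. -/
theorem closedAt_of_residual
    (hres : ∀ (E' : Type u) [Fintype E'] [DecidableEq E'] (ends' : E' → Sym2 V),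
      Residual o a₁ a₂ b v E' ends' → ClosedAt R o a₁ a₂ b E' ends' v)
    (E : Type u) [Fintype E] [DecidableEq E] (ends : E → Sym2 V) : ClosedAt R o a₁ a₂ b E ends v := by
  obtain ⟨E', _, _, ends', hr, hth⟩ := exists_residual_thickening (o := o) (a₁ := a₁) (a₂ := a₂) (b := b)
    (v := v) (Fintype.card E) E ends rfl
  exact closedAt_of_thickening hth (hres E' ends' hr)

/-- The four forms for one weight vector on any finite graph, from the residual class. -/
theorem fourForms_of_residual
    (hres : ∀ (E' : Type u) [Fintype E'] [DecidableEq E'] (ends' : E' → Sym2 V),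
      Residual o a₁ a₂ b v E' ends' → ClosedAt R o a₁ a₂ b E' ends' v)
    {E : Type u} [Fintype E] [DecidableEq E] (ends : E → Sym2 V) (p : E → R) (hp : IsProbVec p) :
    FourForms p ends o a₁ a₂ v b :=
  closedAt_of_residual hres E ends p hp

end Residual

end CaseOne

end Summit.Ventures.PercRepro2
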